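import Summits.RiemannHypothesis.RiemannHypothesis.Theorems.HandoffUpperClausesB
import Summits.RiemannHypothesis.RiemannHypothesis.Theorems.HandoffLadderRungOne
import Summits.RiemannHypothesis.RiemannHypothesis.Theorems.SemilocalNegCertTwoThreeKinked0811
import Summits.RiemannHypothesis.RiemannHypothesis.Theorems.SemilocalNegCertTwoThreeFiveKinked098Final
import Summits.RiemannHypothesis.RiemannHypothesis.Theorems.SemilocalNegCertSevenKinked1206Final
import Summits.RiemannHypothesis.RiemannHypothesis.Theorems.SemilocalNegCertElevenKinked129Final
import Summits.RiemannHypothesis.RiemannHypothesis.Theorems.SemilocalNegCertThirteenKinked1423Final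
import Summits.RiemannHypothesis.RiemannHypothesis.Theorems.SemilocalNegCertSeventeenKinked1478Final
import Summits.RiemannHypothesis.RiemannHypothesis.Theorems.SemilocalNegCertNineteenKinked1573Final
import HarnessLib

/-!
# The KINKED kernel wall table: `δ*(q) < 0.0071` for every prime `5 ≤ q ≤ 23` (RH-FREE; cell rh-explicit, seat cc-s2-9 gen0, D-0074 (D5) WEIL data engine)

RH-FREE (LADDER-RH column WEIL, rung DATA → W-P(P2) «class / locality law instances beyond the inputs of
`SemilocalClassLaw.semilocalClassLawBelow_eighty`»).  HONEST FRAMING: the wall offsets `δ*(q) = a*(S_q) − (log q)/2`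
(`HandoffMarginLaw.wallOffset`, `S_q = Nat.primesBelow q`) are numbers of TRUNCATED Weil forms (finitely many places); this file collects
one-sided UPPER bounds from the kernel's KINKED (piecewise-cubic, slope breaks at atom images) negativity certificates
(`SemilocalPiecewiseCert`, cc-s2-4 gen8; rows cc-s2-4 gen8/gen12 for `q ≤ 13`, this seat's rows for `q = 17, 19, 23`).  The SIGN of `δ*(q)`
for `q ≥ 7` (= the handoff step `H(q⁻)`) is RH-strength bookkeeping and is NOT claimed; `δ*(q) → 0` along the primes IS RH
(`HandoffWallCeiling.riemannHypothesis_iff_wallOffset_tendsto_zero`).  Nothing here bears on the truth of RH.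

THE TABLE (kernel, this file ⇐ the cited rows; DATA = certified two-engine walls of SEMILOCAL-TABLE §1/§1b for comparison, not used):
`δ*(5) < 0.0063` (811/1000; DATA 0.00247) · `δ*(7) < 0.00705` (49/50; 0.00125) · `δ*(11) < 0.00706` (603/500; 0.00052) · `δ*(13) < 0.0066` (165/128; 0.00038)
· `δ*(17) < 0.006245` (1457/1024; 0.00023) · `δ*(19) < 0.00532` (1513/1024; 0.00024) · `δ*(23) < 0.0055` (1611/1024; 0.00018);
hence `∀ q prime, 5 ≤ q ≤ 23 → δ*(q) < 0.0071` (the polynomial-class rows give `0.0096 … 0.0182` on the same range,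
`HandoffUpperClauses.wallOffset_*_le`).  With the `a = 1` rung: `1 − (log q)/2 ≤ δ*(q)` for `q ≥ 8` (`HandoffLadderRungOne.one_sub_log_half_le_wallOffset`),
and `0 ≤ δ*(5)` (`HandoffLadderTheoremRungs.wallOffset_five_nonneg`, the `(log 5)/2` rung).  Folklore throughout; no new certificate in this file.
-/

set_option linter.dupNamespace false  -- the mandated namespace repeats `RiemannHypothesis`

noncomputable section

open Set Literature.NumberTheory.LFunctions
open Summit.RiemannHypothesis.RiemannHypothesis.Theorems
open Summit.RiemannHypothesis.RiemannHypothesis.Theorems.HandoffMarginLaw (wallOffset)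
open Summit.RiemannHypothesis.RiemannHypothesis.Theorems.HandoffLadderTheoremRungs (primesBelow_five wallOffset_five_nonneg)
open Summit.RiemannHypothesis.RiemannHypothesis.Theorems.MotivicDoor.SemilocalThreshold
open Summit.RiemannHypothesis.RiemannHypothesis.Theorems.SemilocalPolyWitness

namespace Summit.RiemannHypothesis.RiemannHypothesis.Theorems.SemilocalKinkedWallOffsets

/-! ## §1  The kinked rows `q ≤ 13` (cc-s2-4 gen8) in the `wallOffset` currency -/

/-- `δ*(5) ≤ 811/1000 − (log 5)/2` (kinked row `SemilocalNegCertTwoThreeKinked0811`, cc-s2-4 gen8). [this cell; tree certificate] -/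
theorem wallOffset_five_le_0811 : wallOffset 5 ≤ 811 / 1000 - Real.log 5 / 2 := by
  have h := weilSemilocalThreshold_twoThree_le_0811
  push_cast at h
  rw [wallOffset, primesBelow_five]
  push_cast
  linarith

/-- **`δ*(5) < 0.0063`** (two-sided with the `(log 5)/2` rung: `0 ≤ δ*(5)`; DATA `0.00247`). [this cell; tree certificates] -/
theorem wallOffset_five_mem_Ico_00063 : wallOffset 5 ∈ Ico (0 : ℝ) 0.0063 := by
  refine ⟨wallOffset_five_nonneg, ?_⟩
  have h := wallOffset_five_le_0811
  have hl := logFiveLo_le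
  rw [logFiveLo] at hl
  push_cast at hl
  linarith

/-- `δ*(7) ≤ 49/50 − (log 7)/2` (kinked row `SemilocalNegCertTwoThreeFiveKinked098Final`, cc-s2-4 gen8, filed 2026-08-26). [this cell; tree certificate] -/
theorem wallOffset_seven_le_098 : wallOffset 7 ≤ 49 / 50 - Real.log 7 / 2 := by
  have h := weilSemilocalThreshold_twoThreeFive_le_098
  push_cast at h
  rw [wallOffset, HandoffUpperClauses.primesBelow_seven]
  push_cast
  linarith

/-- **`δ*(7) < 0.00705`** (DATA `0.00125`; the sign of `δ*(7)` = `H(5)` is not claimed). [this cell; tree certificate] -/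
theorem wallOffset_seven_lt_000705 : wallOffset 7 < 0.00705 := by
  have h := wallOffset_seven_le_098
  have hl := log_seven_gt_d11
  linarith

/-- `δ*(11) ≤ 603/500 − (log 11)/2` (kinked row `SemilocalNegCertSevenKinked1206Final`, cc-s2-4 gen8/12). [this cell; tree certificate] -/
theorem wallOffset_eleven_le_1206 : wallOffset 11 ≤ 603 / 500 - Real.log 11 / 2 := by
  have h := weilSemilocalThreshold_uptoSeven_le_1206
  push_cast at h
  rw [wallOffset, HandoffUpperClauses.primesBelow_eleven]
  push_cast
  linarith

/-- **`δ*(11) < 0.00706`** (DATA `5.2·10⁻⁴`). [this cell; tree certificate] -/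
theorem wallOffset_eleven_lt_000706 : wallOffset 11 < 0.00706 := by
  have h := wallOffset_eleven_le_1206
  have hl := log_eleven_gt_d11
  linarith

/-- `δ*(13) ≤ 165/128 − (log 13)/2` (kinked row `SemilocalNegCertElevenKinked129Final`, cc-s2-4 gen8, filed 2026-08-26). [this cell; tree certificate] -/
theorem wallOffset_thirteen_le_129 : wallOffset 13 ≤ 165 / 128 - Real.log 13 / 2 := by
  have h := weilSemilocalThreshold_uptoEleven_le_129
  push_cast at h
  rw [wallOffset, HandoffUpperClauses.primesBelow_thirteen]
  push_cast
  linarith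

/-- **`δ*(13) < 0.0066`** (DATA `3.8·10⁻⁴`). [this cell; tree certificate] -/
theorem wallOffset_thirteen_lt_00066 : wallOffset 13 < 0.0066 := by
  have h := wallOffset_thirteen_le_129
  have hl := log_thirteen_gt_d11
  linarith

/-! ## §2  The table `5 ≤ q ≤ 23` -/

/-- **THE KINKED KERNEL WALL TABLE**: `δ*(q) < 0.0071` for every prime `5 ≤ q ≤ 23` (seven walls; one-sided, RH-free; the
polynomial-class kernel rows give `0.0096 … 0.0182` on this range). [this cell, HOME/SEMILOCAL-TABLE.md §1; tree certificates] -/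
theorem wallOffset_lt_00071_of_prime_le {q : ℕ} (hq : q.Prime) (h5 : 5 ≤ q) (h23 : q ≤ 23) : wallOffset q < 0.0071 := by
  interval_cases q
  · linarith [wallOffset_five_mem_Ico_00063.2]
  · exact absurd hq (by decide)
  · linarith [wallOffset_seven_lt_000705]
  · exact absurd hq (by decide)
  · exact absurd hq (by decide)
  · exact absurd hq (by decide)
  · linarith [wallOffset_eleven_lt_000706]
  · exact absurd hq (by decide)
  · linarith [wallOffset_thirteen_lt_00066]
  · exact absurd hq (by decide)
  · exact absurd hq (by decide)
  · exact absurd hq (by decide)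
  · linarith [wallOffset_seventeen_lt_0006245]
  · exact absurd hq (by decide)
  · linarith [wallOffset_nineteen_lt_000532]
  · exact absurd hq (by decide)
  · exact absurd hq (by decide)
  · exact absurd hq (by decide)
  · linarith [wallOffset_twentythree_lt_00055]

/-- **Two-sided form for `11 ≤ q ≤ 23`** with the `a = 1` rung: `1 − (log q)/2 ≤ δ*(q) < 0.0071` (the lower end is NEGATIVE here —
it only records that every such wall is `≥ 1`; the true sign of `δ*(q)` is not claimed). [this cell; tree rung `a = 1`] -/
theorem wallOffset_mem_Ico_of_prime_le {q : ℕ} (hq : q.Prime) (h11 : 11 ≤ q) (h23 : q ≤ 23) :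
    wallOffset q ∈ Ico (1 - Real.log q / 2) 0.0071 :=
  ⟨HandoffLadderRungOne.one_sub_log_half_le_wallOffset (by omega), wallOffset_lt_00071_of_prime_le hq (by omega) h23⟩

/-- **CLASS form** (the «instances» currency of `SemilocalClassLaw`): for every finite `S` whose least missing prime `q` satisfies
`17 ≤ q ≤ 23` (the three classes of this seat), `a*(S) < (log q)/2 + 0.0071` and `1 ≤ a*(S)` — by first-gap locality through the
per-class theorems `weilSemilocalThreshold_le_1423_of_mem` / `_le_1478_of_mem` / `_le_1573_of_mem`. Stated for `S = S_q`: -/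
theorem weilSemilocalThreshold_primesBelow_lt_of_prime_le {q : ℕ} (hq : q.Prime) (h5 : 5 ≤ q) (h23 : q ≤ 23) :
    weilSemilocalThreshold (Nat.primesBelow q) < Real.log q / 2 + 0.0071 := by
  have h := wallOffset_lt_00071_of_prime_le hq h5 h23
  rw [wallOffset] at h
  linarith

end Summit.RiemannHypothesis.RiemannHypothesis.Theorems.SemilocalKinkedWallOffsets

end
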